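import Summits.ResolutionOfSingularities.ResolutionOfSingularities.Theorems.UltraWalkTransfer
import Summits.ResolutionOfSingularities.ResolutionOfSingularities.Theorems.ColumnLedger
import HarnessLib

/-!
# UltraWalkLaw — the CERTIFIED UNIFORM BOUND (hyp-free law), the located residual, and the kernels to the port

NODE «UltraWalk» (decomp-res lens-3, gen 30), file 5/5.  Door: the typed Łoś/compactness port
`UniformWalks.CompactnessPort : ∀ d, (∀ B, ¬ UnifBound d B) → ¬ SliceTerminate d` (Theorems/UniformWalkClasses).

* §1 `Level β d p e B` packages a counterexample level (field, root, certified run of length `B + 1`); pigeonhole on the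
  finitely many exponents `pᵉ ≤ d` (`UniformWalks.pow_le_totalDegree_of_run`) and restriction give levels of EVERY
  length at ONE exponent, and the transfer theorem (`UltraWalkTransfer.not_sliceTerminate_of_certRuns`) refutes the slice.
* §2 THE LAW (zero hypotheses): `certifiedPort` — the port for CERTIFIED runs, outright — and
  `unifBoundCert_exists (β) (d) : ∃ B, UnifBoundCert β d B`, from the LANDED `ColumnLedger.walksTerminate_holds` by name.
* §3 THE LOCATED RESIDUAL `BoundedIsolation` (isolation certificates of size bounded in terms of `q` and the degree —
  effective ideal membership: Hermann; van den Dries–Schmidt 1984 §1; not in Mathlib) and the KERNELS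
  `unifBound_exists_of_boundedIsolation`, `compactnessPort_of_boundedIsolation` (THE DOOR), and
  `unifFin_exists_of_boundedIsolation` (item 33493 `UWFiniteFieldCriterion : ∀ d, ∃ B, UnifFin d B`, verbatim).

No `sorry`, standard axioms. (Sources: Marker2002, Thm 2.1.4, Ex. 2.5.19; vandenDriesSchmidt1984, §1; Hauser2010, §G.)
-/

noncomputable section

open MvPolynomial
open Literature.AlgebraicGeometry.Resolution
open Literature.AlgebraicGeometry.Resolution.Hauser2010
open Literature.AlgebraicGeometry.Resolution.PointBlowup
open Summit.ResolutionOfSingularities.ResolutionOfSingularities.Theorems.TightDefectClasses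
open Summit.ResolutionOfSingularities.ResolutionOfSingularities.Theorems.UniformWalks (ForcedRun UnifBound UnifFin
  SliceTerminate CompactnessPort totalDegree_run_le pow_le_totalDegree_of_run sliceTerminate_of_walksTerminate
  unifFin_of_unifBound)

namespace Summit.ResolutionOfSingularities.ResolutionOfSingularities.Theorems.UltraWalk

/-! ## §1 Counterexample levels and the pigeonhole on exponents -/

/-- A counterexample LEVEL to `UnifBoundCert β d B` at exponent `pᵉ`: a perfect field of characteristic `p`, a root of
exponent `pᵉ` and degree `≤ d`, and a `β`-certified forced run of length `B + 1` from it. NEW TYPED OBJECT (support).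
[folklore] -/
structure Level (β : ℕ → ℕ) (d p e B : ℕ) : Type 1 where
  /-- the field of the level -/
  K : Type
  /-- … a field -/
  [instField : Field K]
  /-- … of characteristic `p` -/
  [instCharP : CharP K p]
  /-- … perfect -/
  [instPerfect : PerfectField K]
  /-- … with decidable equality (the model's `step` branches on `b i = 0`) -/
  [instDec : DecidableEq K]
  /-- the start -/
  s₀ : State (Fin 3) K
  /-- … a root of exponent `pᵉ` -/
  root : IsRoot (p ^ e) s₀
  /-- … of degree `≤ d` -/
  deg : s₀.F.totalDegree ≤ d
  /-- the certified forced run of length `B + 1` -/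
  run : CertRun β (p ^ e) s₀ (B + 1)

/-- Restriction of a level to a shorter length. [folklore] -/
def Level.restrict {β : ℕ → ℕ} {d p e B B' : ℕ} (L : Level β d p e B) (h : B' ≤ B) : Level β d p e B' :=
  letI := L.instField; letI := L.instCharP; letI := L.instPerfect; letI := L.instDec
  ⟨L.K, L.s₀, L.root, L.deg, L.run.restrict (Nat.succ_le_succ h)⟩

/-- At a level the exponent is small: `pᵉ ≤ d`, hence `p ≤ d` and `e ≤ d`. [folklore] -/
theorem Level.pow_le {β : ℕ → ℕ} {d p e B : ℕ} (L : Level β d p e B) : p ^ e ≤ d :=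
  letI := L.instField; letI := L.instDec
  pow_le_totalDegree_of_run L.root L.deg L.run.toForcedRun

/-- Levels of every length at one exponent refute the slice (the transfer theorem, instances threaded explicitly).
[folklore] -/
theorem not_sliceTerminate_of_levels {β : ℕ → ℕ} {d p e : ℕ} (hp : p.Prime) (he : 1 ≤ e) (L : ∀ n, Level β d p e n) :
    ¬ SliceTerminate d :=
  @not_sliceTerminate_of_certRuns β d p e hp he (fun n => (L n).K) (fun n => (L n).instField) (fun n => (L n).instCharP)
    (fun n => (L n).instPerfect) (fun n => (L n).instDec) (fun n => (L n).s₀) (fun n => (L n).root) (fun n => (L n).deg)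
    fun n => (L n).run

/-- Unpacking a failure of the certified bound into a level (with its exponent). [folklore] -/
theorem exists_level_of_not_unifBoundCert {β : ℕ → ℕ} {d B : ℕ} (h : ¬ UnifBoundCert β d B) :
    ∃ p e : ℕ, p.Prime ∧ 1 ≤ e ∧ Nonempty (Level β d p e B) := by
  by_contra hne
  refine h fun p hp e he K _ _ _ _ s₀ hr hd R => hne ⟨p, e, hp, he, ⟨⟨K, s₀, hr, hd, R⟩⟩⟩

/-- **PIGEONHOLE + RESTRICTION**: if the certified bound fails at every length, then at ONE exponent `pᵉ ≤ d` there are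
levels of every length. [folklore] -/
theorem exists_levels_of_forall_not {β : ℕ → ℕ} {d : ℕ} (h : ∀ B, ¬ UnifBoundCert β d B) :
    ∃ p e : ℕ, p.Prime ∧ 1 ≤ e ∧ ∀ n, Nonempty (Level β d p e n) := by
  choose pB eB hp he hne using fun B => exists_level_of_not_unifBoundCert (h B)
  have hpd : ∀ B, pB B < d + 1 := fun B => by
    obtain ⟨L⟩ := hne B
    exact Nat.lt_succ_of_le ((Nat.le_self_pow (Nat.one_le_iff_ne_zero.mp (he B)) (pB B)).trans L.pow_le)
  have hed : ∀ B, eB B < d + 1 := fun B => by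
    obtain ⟨L⟩ := hne B
    exact Nat.lt_succ_of_le ((Nat.lt_pow_self (hp B).one_lt).le.trans L.pow_le)
  let f : ℕ → Fin (d + 1) × Fin (d + 1) := fun B => (⟨pB B, hpd B⟩, ⟨eB B, hed B⟩)
  obtain ⟨y, hy⟩ := Finite.exists_infinite_fiber f
  have hinf : (f ⁻¹' {y}).Infinite := Set.infinite_coe_iff.mp hy
  obtain ⟨B₀, hB₀⟩ := hinf.nonempty
  refine ⟨pB B₀, eB B₀, hp B₀, he B₀, fun n => ?_⟩
  obtain ⟨B, hB, hnB⟩ := hinf.exists_gt n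
  have hfB : f B = f B₀ := by rw [Set.mem_preimage, Set.mem_singleton_iff] at hB hB₀; rw [hB, hB₀]
  have h1 : pB B = pB B₀ := by simpa [f] using congrArg (fun z => (z.1 : ℕ)) hfB
  have h2 : eB B = eB B₀ := by simpa [f] using congrArg (fun z => (z.2 : ℕ)) hfB
  obtain ⟨L⟩ := hne B
  rw [h1, h2] at L
  exact ⟨L.restrict hnB.le⟩

/-! ## §2 THE LAW: the certified port, outright; the certified uniform bound, from ColumnLedger by name -/

/-- **THE CERTIFIED PORT (decided, zero hypotheses)**: `UniformWalks.CompactnessPort` with certified runs in place of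
runs — if the `β`-certified bound fails at every length in degree `≤ d`, the slice `SliceTerminate d` fails (Łoś transfer
to the ultraproduct of the levels). [folklore] -/
theorem certifiedPort (β : ℕ → ℕ) (d : ℕ) (h : ∀ B, ¬ UnifBoundCert β d B) : ¬ SliceTerminate d := by
  obtain ⟨p, e, hp, he, hL⟩ := exists_levels_of_forall_not h
  exact not_sliceTerminate_of_levels hp he fun n => Classical.choice (hL n)

/-- **THE LAW — `∃ B, UnifBoundCert β d B` for EVERY certificate schedule `β` and EVERY degree `d`** (zero hypotheses):
over all perfect fields of all characteristics at once, `β`-certified forced runs from roots of degree `≤ d` have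
UNIFORMLY BOUNDED length.  Proof: the certified port + the landed `ColumnLedger.walksTerminate_holds` BY NAME.
[composition] [folklore] -/
theorem unifBoundCert_exists (β : ℕ → ℕ) (d : ℕ) : ∃ B, UnifBoundCert β d B := by
  by_contra h
  exact certifiedPort β d (not_exists.mp h) (sliceTerminate_of_walksTerminate ColumnLedger.walksTerminate_holds d)

/-! ## §3 The located residual and the kernels to the door -/

/-- **THE LOCATED RESIDUAL `BoundedIsolation`** — isolation certificates of BOUNDED SIZE: for every exponent `q` and
degree `D` there is a size `β(q, D)` such that over EVERY field an isolated top point of a polynomial of degree `≤ D` in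
three variables has an isolation certificate of size `≤ β` (bounded exponent in the local Nullstellensatz and bounded
cofactor degrees in the ideal membership — Hermann's bounds, uniform in the field).  TYPED, NOT PROVED here (effective
commutative algebra absent from Mathlib); `β` depends on `(q, D)` only, never on the field.  THE NEW LOCATED DOOR of the
line. [new]
(Sources: vandenDriesSchmidt1984, §1 (bounds for ideal membership and primary decomposition in K[X], uniform in K);
Kollar1988 (effective Nullstellensatz: the exponent); Marker2002, Ex. 2.5.19.) -/
def BoundedIsolation : Prop :=
  ∀ q D : ℕ, ∃ β : ℕ, ∀ (K : Type) [Field K] (F : MvPolynomial (Fin 3) K),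
    F.totalDegree ≤ D → IsolatedTop q F → IsolatedTopCert q β F

/-- **KERNEL: bounded isolation ⟹ the UNIFORM BOUND `∀ d, ∃ B, UnifBound d B`** (certify every run with the schedule
`β i := max_{q ≤ d} β(q, 2^i·d)` and apply the law). [folklore] -/
theorem unifBound_exists_of_boundedIsolation (h : BoundedIsolation) (d : ℕ) : ∃ B, UnifBound d B := by
  classical
  choose βf hβf using h
  let β : ℕ → ℕ := fun i => (Finset.range (d + 1)).sup fun q => βf q (2 ^ i * d)
  obtain ⟨B, hB⟩ := unifBoundCert_exists β d
  refine ⟨B, fun p hp e he K _ _ _ _ s₀ hr hd R => hB p hp e he K s₀ hr hd ⟨R, fun i hi => ?_⟩⟩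
  have hq : p ^ e < d + 1 := Nat.lt_succ_of_le (pow_le_totalDegree_of_run hr hd R)
  have hc : IsolatedTopCert (p ^ e) (βf (p ^ e) (2 ^ i * d)) (R.st i).F :=
    hβf (p ^ e) (2 ^ i * d) K (R.st i).F ((totalDegree_run_le R i hi.le).trans (Nat.mul_le_mul_left _ hd))
      (R.isolated i hi)
  exact isolatedTopCert_mono (Finset.le_sup (f := fun q => βf q (2 ^ i * d)) (Finset.mem_range.mpr hq)) hc

/-- **KERNEL — THE DOOR: bounded isolation ⟹ `UniformWalks.CompactnessPort`** (the port's hypothesis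
`∀ B, ¬ UnifBound d B` is then absurd). [folklore] -/
theorem compactnessPort_of_boundedIsolation (h : BoundedIsolation) : CompactnessPort := by
  intro d hall _
  obtain ⟨B, hB⟩ := unifBound_exists_of_boundedIsolation h d
  exact hall B hB

/-- **KERNEL — item 33493 `MaxContactCut.UWFiniteFieldCriterion` (`∀ d, ∃ B, UnifFin d B`, verbatim) from bounded
isolation** (finite fields are fields: `UniformWalks.unifFin_of_unifBound`). [folklore] -/
theorem unifFin_exists_of_boundedIsolation (h : BoundedIsolation) : ∀ d : ℕ, ∃ B : ℕ, UnifFin d B := fun d => by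
  obtain ⟨B, hB⟩ := unifBound_exists_of_boundedIsolation h d
  exact ⟨B, unifFin_of_unifBound hB⟩

/-- **The port is EXACTLY the residual's job**: with the law in hand, `CompactnessPort` ⟺ `∀ d, ∃ B, UnifBound d B`
(the forward direction is the tree's `sliceTerminate_iff_exists_unifBound` fed with ColumnLedger). [folklore] -/
theorem compactnessPort_iff_unifBound_exists : CompactnessPort ↔ ∀ d, ∃ B, UnifBound d B := by
  refine ⟨fun hC d => ?_, fun h d hall _ => ?_⟩
  · by_contra hne
    exact hC d (not_exists.mp hne) (sliceTerminate_of_walksTerminate ColumnLedger.walksTerminate_holds d)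
  · obtain ⟨B, hB⟩ := h d
    exact hall B hB

end Summit.ResolutionOfSingularities.ResolutionOfSingularities.Theorems.UltraWalk
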